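import Summits.ABC.ABC.Theorems.TwistAmplificationSharpModerateLawFewDeepBudget
import Literature.NumberTheory.CubicFields.MaximalDiscriminantValuation

/-!
# Crux `TwistAmplification.SharpModerateLaw` (stmt-ABC-1975), line `unit-plane-conic-two-torsion`:
local minimality of index-form data of maximal cubic rings

Support file (`--supports stmt-ABC-1975`, stub `stub_ringCensus`, wave 2) for the inverse dictionary
`CoreLaw → CoreLawIF` of `…SharpModerateLawCoreDefs.lean`: an index-form datum `q = (u, v)` of a MAXIMAL binary cubic
form `F` (value `F(q) ≠ 0`, content `g = gcd(u, v)`) gives Weierstrass invariants `(c₄, c₆) = (16·H_F(q), −32·G_F(q))`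
(`H_F = hessAt F`, `G_F = covAt F` of `…SharpModerateLawDefs.lean`), and this file proves that they are

* **minimal at every prime `p ≥ 5` with `p² ∤ g`** (`data_tf_five`, registered: `¬ (p⁴ ∣ c₄ ∧ p⁶ ∣ c₆)`), the converse
  companion of the landed `contentOK_of_data` (`…SyzygyTransfer.lean`);
* **boundedly non-minimal at `2` and `3`** when `2⁴ ∤ g` resp. `3⁴ ∤ g` (`data_descale_two`, `data_descale_three`,
  registered, descaling depth `T = 2`: `¬ (2^{8+4·2} ∣ c₄ ∧ 2^{11+6·2} ∣ c₆)`, `¬ (3^{5+4·2} ∣ c₄ ∧ 3^{9+6·2} ∣ c₆)`).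

Proof.  Write `q = g·q₀` with `q₀ = (u₀, v₀)` primitive; `H_F(q) = g²H_F(q₀)`, `G_F(q) = g³G_F(q₀)`,
`F(q) = g³F(q₀)` (homogeneity).  The assumed divisibilities and `v_p(g) ≤ e` bound `v_p(H_F(q₀))`, `v_p(G_F(q₀))` below
(`pow_dvd_of_pow_dvd_pow_mul`), Cayley's syzygy `G² + 27·D·F² = 4H³` (`syzygy`) transfers them to `27·D·F(q₀)²`, and
the discriminant bound of a maximal form (`v_p(D) ≤ 2` for `p ≥ 5`, `v₂(D) ≤ 3`, `v₃(D) ≤ 5`: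
`BinaryCubic.not_cube_dvd_disc_of_memU` & co., Literature `MaximalDiscriminantValuation.lean`) bounds `v_p(F(q₀))`
below (`pow_dvd_of_pow_dvd_mul_sq`).  RESULTANT STEP (`dvd_disc_of_dvd_eval_hessAt`): by the cofactor identities
`A·F + B·H_F = D·u⁴`, `A'·F + B'·H_F = D·v⁴` (`FewDeepSlice.cofactor_fst/snd`, `…FewDeepBudget.lean`) a common divisor of
`F(q₀)` and `H_F(q₀)` at a primitive point divides `D`; at `p = 2, 3` this already contradicts `2⁴ ∤ D`, `3⁶ ∤ D`
(one finds `2⁴ ∣ F(q₀), H_F(q₀)` resp. `3⁶ ∣ F(q₀), H_F(q₀)`).  At `p ≥ 5` one finds `p² ∣ F(q₀)`, `p ∣ H_F(q₀)`, hence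
`p ∣ D`, and the LOCAL STEP `dvd_deriv_of_dvd_disc` — for `p ∣ D`, `p ∤ F`: a zero of `F` and `H_F` modulo `p` is the
multiple root of `F (mod p)`, i.e. `p ∣ F_u, F_v` there (explicit invariant theory around the root `(−Q : 2P)` of the
Hessian, `BinaryCubic.hessQ_sq_sub`, and the triple-root normal form `27a²F = (3au + bv)³ (mod P, Q)`) — makes `q₀` a
singular zero with `p² ∣ F(q₀)`, contradicting `F ∈ U_p` (`RingOfForm.memU_of_isMaximal`,
`BinaryCubic.memU_iff_forall_coprime`, Literature `MemUCriterion.lean`).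
-/

-- the mandated summit namespace `Summit.ABC.ABC` (summit = problem) trips the duplicate-namespace linter
set_option linter.dupNamespace false

namespace Summit.ABC.ABC.Theorems.SharpModerateLaw

open Literature.NumberTheory.CubicFields

/-! ## 1. Arithmetic helpers -/

/-- `p^(e+1) ∤ g` and `p^n ∣ g^k · x` with `k·e + m ≤ n` give `p^m ∣ x`. -/
theorem pow_dvd_of_pow_dvd_pow_mul {p : ℕ} (hp : p.Prime) {g x : ℤ} {e k m n : ℕ}
    (hg : ¬ (p : ℤ) ^ (e + 1) ∣ g) (h : (p : ℤ) ^ n ∣ g ^ k * x) (hn : k * e + m ≤ n) : (p : ℤ) ^ m ∣ x := by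
  haveI := Fact.mk hp
  rcases eq_or_ne x 0 with rfl | hx
  · exact dvd_zero _
  have hg0 : g ≠ 0 := by rintro rfl; exact hg (dvd_zero _)
  rw [padicValInt_dvd_iff] at hg h ⊢
  have hvg : padicValInt p g ≤ e := by
    by_contra hlt
    exact hg (Or.inr (by omega))
  rcases h with h | h
  · exact absurd h (mul_ne_zero (pow_ne_zero _ hg0) hx)
  rw [padicValInt.mul (pow_ne_zero _ hg0) hx] at h
  have hpow : padicValInt p (g ^ k) = k * padicValInt p g := by
    simp only [padicValInt, Int.natAbs_pow, padicValNat.pow]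
  rw [hpow] at h
  have := Nat.mul_le_mul_left k hvg
  exact Or.inr (by omega)

/-- `p^(d+1) ∤ D`, `F ≠ 0`, `p^n ∣ D·F²` with `d + 2m ≤ n + 1` give `p^m ∣ F`. -/
theorem pow_dvd_of_pow_dvd_mul_sq {p : ℕ} (hp : p.Prime) {D F : ℤ} {d n m : ℕ}
    (hD : ¬ (p : ℤ) ^ (d + 1) ∣ D) (hF : F ≠ 0) (h : (p : ℤ) ^ n ∣ D * F ^ 2) (hm : d + 2 * m ≤ n + 1) :
    (p : ℤ) ^ m ∣ F := by
  haveI := Fact.mk hp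
  have hD0 : D ≠ 0 := by rintro rfl; exact hD (dvd_zero _)
  rw [padicValInt_dvd_iff] at hD h ⊢
  have hvD : padicValInt p D ≤ d := by
    by_contra hlt
    exact hD (Or.inr (by omega))
  rcases h with h | h
  · exact absurd h (mul_ne_zero hD0 (pow_ne_zero _ hF))
  rw [padicValInt.mul hD0 (pow_ne_zero _ hF), pow_two, padicValInt.mul hF hF] at h
  exact Or.inr (by omega)

/-- **Resultant step.** A common divisor of `F(u,v)` and `H_F(u,v)` at a primitive point `(u, v)` divides `Disc F`
(cofactor identities `A·F + B·H_F = D·u⁴`, `A'·F + B'·H_F = D·v⁴` of `FewDeepSlice`). -/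
theorem dvd_disc_of_dvd_eval_hessAt {F : BinaryCubic ℤ} {u v n : ℤ} (hcop : IsCoprime u v)
    (hF : n ∣ F.eval u v) (hH : n ∣ hessAt F u v) : n ∣ F.disc := by
  have h1 : n ∣ F.disc * u ^ 4 := by
    rw [← FewDeepSlice.cofactor_fst F u v]
    exact dvd_add (dvd_mul_of_dvd_right hF _) (dvd_mul_of_dvd_right hH _)
  have h2 : n ∣ F.disc * v ^ 4 := by
    rw [← FewDeepSlice.cofactor_snd F u v]
    exact dvd_add (dvd_mul_of_dvd_right hF _) (dvd_mul_of_dvd_right hH _)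
  obtain ⟨a, b, hab⟩ := IsCoprime.pow hcop (m := 4) (n := 4)
  rw [show F.disc = a * (F.disc * u ^ 4) + b * (F.disc * v ^ 4) by linear_combination -F.disc * hab]
  exact dvd_add (dvd_mul_of_dvd_right h1 _) (dvd_mul_of_dvd_right h2 _)

/-- Primitive decomposition of a datum: `q = g·(u, v)` with `g = gcd q`, `(u, v)` coprime, and the homogeneity
`H_F(q) = g²H_F(u,v)`, `G_F(q) = g³G_F(u,v)`, `F(q) = g³F(u,v)` (for `F(q) ≠ 0`, so that `q ≠ 0`). -/
theorem exists_primitive (F : BinaryCubic ℤ) {q : ℤ × ℤ} (hq : F.eval q.1 q.2 ≠ 0) :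
    ∃ u v : ℤ, IsCoprime u v ∧ hessAt F q.1 q.2 = (Int.gcd q.1 q.2 : ℤ) ^ 2 * hessAt F u v ∧
      covAt F q.1 q.2 = (Int.gcd q.1 q.2 : ℤ) ^ 3 * covAt F u v ∧
      F.eval q.1 q.2 = (Int.gcd q.1 q.2 : ℤ) ^ 3 * F.eval u v ∧ F.eval u v ≠ 0 := by
  have hg0 : 0 < Int.gcd q.1 q.2 := by
    refine Int.gcd_pos_iff.mpr ?_
    by_contra h
    push Not at h
    apply hq
    rw [h.1, h.2]
    simp [BinaryCubic.eval]
  obtain ⟨u, v, hcop, hu, hv⟩ := Int.exists_gcd_one hg0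
  obtain ⟨g, hg⟩ : ∃ g : ℤ, (Int.gcd q.1 q.2 : ℤ) = g := ⟨_, rfl⟩
  rw [hg] at hu hv ⊢
  have eH : hessAt F q.1 q.2 = g ^ 2 * hessAt F u v := by rw [hu, hv]; simp only [hessAt]; ring
  have eG : covAt F q.1 q.2 = g ^ 3 * covAt F u v := by rw [hu, hv]; simp only [covAt]; ring
  have eF : F.eval q.1 q.2 = g ^ 3 * F.eval u v := by rw [hu, hv]; simp only [BinaryCubic.eval]; ring
  refine ⟨u, v, Int.isCoprime_iff_gcd_eq_one.mpr hcop, eH, eG, eF, fun h => hq ?_⟩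
  rw [eF, h, mul_zero]

/-- From `p^mH ∣ H_F(u,v)` and `p^mG ∣ G_F(u,v)`: `p^n ∣ 27·D·F(u,v)²` for `n ≤ 3mH`, `n ≤ 2mG` (Cayley's syzygy
`G² + 27·D·F² = 4H³`). -/
theorem pow_dvd_disc_mul_sq {p : ℕ} {F : BinaryCubic ℤ} {u v : ℤ} {mH mG n : ℕ}
    (hH : (p : ℤ) ^ mH ∣ hessAt F u v) (hG : (p : ℤ) ^ mG ∣ covAt F u v) (h3 : n ≤ 3 * mH) (h2 : n ≤ 2 * mG) :
    (p : ℤ) ^ n ∣ 27 * F.disc * F.eval u v ^ 2 := by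
  rw [show 27 * F.disc * F.eval u v ^ 2 = 4 * hessAt F u v ^ 3 - covAt F u v ^ 2 by
    linear_combination syzygy F u v]
  refine dvd_sub (dvd_mul_of_dvd_right ((pow_dvd_pow _ h3).trans ?_) _) ((pow_dvd_pow _ h2).trans ?_)
  · rw [pow_mul']; exact pow_dvd_pow_of_dvd hH 3
  · rw [pow_mul']; exact pow_dvd_pow_of_dvd hG 2

/-! ## 2. The local step at a prime `p ≥ 5` dividing the discriminant -/

/-- **The common zero of `F` and `H_F` modulo `p ∣ Disc` is the multiple root.** For a prime `p ≥ 5`, a form `f`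
that is not a multiple of `p` with `p ∣ Disc f`, and a point `(u, v)` with `p ∣ f(u,v)`, `p ∣ H_f(u,v)`:
`p ∣ f_u(u,v)` and `p ∣ f_v(u,v)`.  With `(P, Q, R)` the Hessian coefficients: if `p ∤ P`, then
`4P·H_f = (2Pu + Qv)² + 3·Disc·v²` forces `p ∣ 2Pu + Qv`, and `4P²·f_u + 9a·Disc·v²`, `4P²·f_v + 3b·Disc·v²` are
multiples of `2Pu + Qv`; symmetrically if `p ∤ R`; if `p ∣ P, Q, R` (triple root) then `27a²f ≡ (3au + bv)³`,
`3a·f_u ≡ (3au + bv)²`, `9a²·f_v ≡ b(3au + bv)²` (or the mirror identities with `cu + 3dv` when `p ∣ a`, `p ∤ d`). -/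
theorem dvd_deriv_of_dvd_disc {p : ℕ} (hp : p.Prime) (hp5 : 5 ≤ p) {f : BinaryCubic ℤ}
    (hf : ¬ f.IsMultiple p) (hD : (p : ℤ) ∣ f.disc) {u v : ℤ} (hfuv : (p : ℤ) ∣ f.eval u v)
    (hH : (p : ℤ) ∣ hessAt f u v) : (p : ℤ) ∣ f.derivU u v ∧ (p : ℤ) ∣ f.derivV u v := by
  have hp' : Prime (p : ℤ) := Nat.prime_iff_prime_int.mp hp
  have hnd2 : ¬ (p : ℤ) ∣ 2 := fun h => by have := Int.le_of_dvd (by norm_num) h; omega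
  have hnd3 : ¬ (p : ℤ) ∣ 3 := fun h => by have := Int.le_of_dvd (by norm_num) h; omega
  have hnd4 : ¬ (p : ℤ) ∣ 4 := fun h => hnd2 (hp'.dvd_of_dvd_pow (show (p : ℤ) ∣ 2 ^ 2 by simpa using h))
  have hnd9 : ¬ (p : ℤ) ∣ 9 := fun h => hnd3 (hp'.dvd_of_dvd_pow (show (p : ℤ) ∣ 3 ^ 2 by simpa using h))
  -- `p ∣ c·x`, `p ∤ c` ⟹ `p ∣ x`
  have strip : ∀ {c x : ℤ}, ¬ (p : ℤ) ∣ c → (p : ℤ) ∣ c * x → (p : ℤ) ∣ x := fun hc h =>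
    (hp'.dvd_or_dvd h).resolve_left hc
  have nd_mul : ∀ {c x : ℤ}, ¬ (p : ℤ) ∣ c → ¬ (p : ℤ) ∣ x → ¬ (p : ℤ) ∣ c * x := fun hc hx h =>
    (hp'.dvd_or_dvd h).elim hc hx
  have nd_sq : ∀ {x : ℤ}, ¬ (p : ℤ) ∣ x → ¬ (p : ℤ) ∣ x ^ 2 := fun hx h => hx (hp'.dvd_of_dvd_pow h)
  obtain ⟨P, hP⟩ : ∃ P : ℤ, P = f.b ^ 2 - 3 * f.a * f.c := ⟨_, rfl⟩
  obtain ⟨Q, hQ⟩ : ∃ Q : ℤ, Q = f.b * f.c - 9 * f.a * f.d := ⟨_, rfl⟩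
  obtain ⟨R, hR⟩ : ∃ R : ℤ, R = f.c ^ 2 - 3 * f.b * f.d := ⟨_, rfl⟩
  have hdisc : Q ^ 2 - 4 * P * R = -3 * f.disc := by rw [hP, hQ, hR]; exact BinaryCubic.hessQ_sq_sub f
  have hHPQR : hessAt f u v = P * u ^ 2 + Q * u * v + R * v ^ 2 := by simp only [hessAt, hP, hQ, hR]
  by_cases hPp : (p : ℤ) ∣ P
  · by_cases hRp : (p : ℤ) ∣ R
    · -- the Hessian vanishes modulo `p`: `p ∣ Q`, triple root
      have hQp : (p : ℤ) ∣ Q := by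
        refine hp'.dvd_of_dvd_pow (n := 2) ?_
        rw [show Q ^ 2 = 4 * P * R + (-3) * f.disc by linear_combination hdisc]
        exact dvd_add (dvd_mul_of_dvd_left (dvd_mul_of_dvd_right hPp 4) _) (dvd_mul_of_dvd_right hD _)
      by_cases ha : (p : ℤ) ∣ f.a
      · have hb : (p : ℤ) ∣ f.b := by
          refine hp'.dvd_of_dvd_pow (n := 2) ?_
          rw [show f.b ^ 2 = P + 3 * f.a * f.c by rw [hP]; ring]
          exact dvd_add hPp (dvd_mul_of_dvd_left (dvd_mul_of_dvd_right ha 3) _)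
        by_cases hd : (p : ℤ) ∣ f.d
        · exfalso
          have hc : (p : ℤ) ∣ f.c := by
            refine hp'.dvd_of_dvd_pow (n := 2) ?_
            rw [show f.c ^ 2 = R + 3 * f.b * f.d by rw [hR]; ring]
            exact dvd_add hRp (dvd_mul_of_dvd_right hd _)
          exact hf ⟨ha, hb, hc, hd⟩
        · -- triple root `(3d : −c)`: `ℓ' = cu + 3dv`
          have hl : (p : ℤ) ∣ f.c * u + 3 * f.d * v := by
            refine hp'.dvd_of_dvd_pow (n := 3) ?_
            rw [show (f.c * u + 3 * f.d * v) ^ 3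
                = 27 * f.d ^ 2 * f.eval u v + 9 * f.d * R * u ^ 2 * v + (f.c * R + 3 * f.d * Q) * u ^ 3 by
              simp only [hQ, hR, BinaryCubic.eval]; ring]
            exact dvd_add (dvd_add (dvd_mul_of_dvd_right hfuv _)
              (dvd_mul_of_dvd_left (dvd_mul_of_dvd_left (dvd_mul_of_dvd_right hRp _) _) _))
              (dvd_mul_of_dvd_left (dvd_add (dvd_mul_of_dvd_right hRp _) (dvd_mul_of_dvd_right hQp _)) _)
          refine ⟨strip (nd_mul hnd9 (nd_sq hd)) ?_, strip (nd_mul hnd3 hd) ?_⟩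
          · rw [show 9 * f.d ^ 2 * f.derivU u v = f.c * (f.c * u + 3 * f.d * v) ^ 2 - 6 * f.d * R * u * v
                - (f.c * R + 3 * f.d * Q) * u ^ 2 by simp only [hQ, hR, BinaryCubic.derivU]; ring]
            exact dvd_sub (dvd_sub (dvd_mul_of_dvd_right (dvd_pow hl two_ne_zero) _)
              (dvd_mul_of_dvd_left (dvd_mul_of_dvd_left (dvd_mul_of_dvd_right hRp _) _) _))
              (dvd_mul_of_dvd_left (dvd_add (dvd_mul_of_dvd_right hRp _) (dvd_mul_of_dvd_right hQp _)) _)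
          · rw [show 3 * f.d * f.derivV u v = (f.c * u + 3 * f.d * v) ^ 2 - R * u ^ 2 by
              simp only [hR, BinaryCubic.derivV]; ring]
            exact dvd_sub (dvd_pow hl two_ne_zero) (dvd_mul_of_dvd_left hRp _)
      · -- triple root `(−b : 3a)`: `ℓ = 3au + bv`
        have hl : (p : ℤ) ∣ 3 * f.a * u + f.b * v := by
          refine hp'.dvd_of_dvd_pow (n := 3) ?_
          rw [show (3 * f.a * u + f.b * v) ^ 3
              = 27 * f.a ^ 2 * f.eval u v + 9 * f.a * P * u * v ^ 2 + (f.b * P + 3 * f.a * Q) * v ^ 3 by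
            simp only [hP, hQ, BinaryCubic.eval]; ring]
          exact dvd_add (dvd_add (dvd_mul_of_dvd_right hfuv _)
            (dvd_mul_of_dvd_left (dvd_mul_of_dvd_left (dvd_mul_of_dvd_right hPp _) _) _))
            (dvd_mul_of_dvd_left (dvd_add (dvd_mul_of_dvd_right hPp _) (dvd_mul_of_dvd_right hQp _)) _)
        refine ⟨strip (nd_mul hnd3 ha) ?_, strip (nd_mul hnd9 (nd_sq ha)) ?_⟩
        · rw [show 3 * f.a * f.derivU u v = (3 * f.a * u + f.b * v) ^ 2 - P * v ^ 2 by
            simp only [hP, BinaryCubic.derivU]; ring]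
          exact dvd_sub (dvd_pow hl two_ne_zero) (dvd_mul_of_dvd_left hPp _)
        · rw [show 9 * f.a ^ 2 * f.derivV u v = f.b * (3 * f.a * u + f.b * v) ^ 2 - 6 * f.a * P * u * v
              - (f.b * P + 3 * f.a * Q) * v ^ 2 by simp only [hP, hQ, BinaryCubic.derivV]; ring]
          exact dvd_sub (dvd_sub (dvd_mul_of_dvd_right (dvd_pow hl two_ne_zero) _)
            (dvd_mul_of_dvd_left (dvd_mul_of_dvd_left (dvd_mul_of_dvd_right hPp _) _) _))
            (dvd_mul_of_dvd_left (dvd_add (dvd_mul_of_dvd_right hPp _) (dvd_mul_of_dvd_right hQp _)) _)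
    · -- `p ∤ R`: the root `(2R : −Q)` of the Hessian, `L' = Qu + 2Rv`
      have hL : (p : ℤ) ∣ Q * u + 2 * R * v := by
        refine hp'.dvd_of_dvd_pow (n := 2) ?_
        rw [show (Q * u + 2 * R * v) ^ 2 = 4 * R * hessAt f u v - 3 * f.disc * u ^ 2 by
          rw [hHPQR]; linear_combination u ^ 2 * hdisc]
        exact dvd_sub (dvd_mul_of_dvd_right hH _) (dvd_mul_of_dvd_left (dvd_mul_of_dvd_right hD 3) _)
      refine ⟨strip (nd_mul hnd4 (nd_sq hRp)) ?_, strip (nd_mul hnd4 (nd_sq hRp)) ?_⟩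
      · rw [show 4 * R ^ 2 * f.derivU u v
            = (Q * u + 2 * R * v) * (4 * f.b * R * u + f.c * (Q * u + 2 * R * v) - 2 * f.c * Q * u)
              - 3 * f.c * f.disc * u ^ 2 by
          simp only [hQ, hR, BinaryCubic.derivU, BinaryCubic.disc_eq]; ring]
        exact dvd_sub (dvd_mul_of_dvd_left hL _)
          (dvd_mul_of_dvd_left (dvd_mul_of_dvd_right hD _) _)
      · rw [show 4 * R ^ 2 * f.derivV u v
            = (Q * u + 2 * R * v) * (4 * f.c * R * u + 3 * f.d * (Q * u + 2 * R * v) - 6 * f.d * Q * u)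
              - 9 * f.d * f.disc * u ^ 2 by
          simp only [hQ, hR, BinaryCubic.derivV, BinaryCubic.disc_eq]; ring]
        exact dvd_sub (dvd_mul_of_dvd_left hL _)
          (dvd_mul_of_dvd_left (dvd_mul_of_dvd_right hD _) _)
  · -- `p ∤ P`: the root `(−Q : 2P)` of the Hessian, `L = 2Pu + Qv`
    have hL : (p : ℤ) ∣ 2 * P * u + Q * v := by
      refine hp'.dvd_of_dvd_pow (n := 2) ?_
      rw [show (2 * P * u + Q * v) ^ 2 = 4 * P * hessAt f u v - 3 * f.disc * v ^ 2 by
        rw [hHPQR]; linear_combination v ^ 2 * hdisc]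
      exact dvd_sub (dvd_mul_of_dvd_right hH _) (dvd_mul_of_dvd_left (dvd_mul_of_dvd_right hD 3) _)
    refine ⟨strip (nd_mul hnd4 (nd_sq hPp)) ?_, strip (nd_mul hnd4 (nd_sq hPp)) ?_⟩
    · rw [show 4 * P ^ 2 * f.derivU u v
          = (2 * P * u + Q * v) * (3 * f.a * (2 * P * u + Q * v) - 6 * f.a * Q * v + 4 * f.b * P * v)
            - 9 * f.a * f.disc * v ^ 2 by
        simp only [hP, hQ, BinaryCubic.derivU, BinaryCubic.disc_eq]; ring]
      exact dvd_sub (dvd_mul_of_dvd_left hL _)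
        (dvd_mul_of_dvd_left (dvd_mul_of_dvd_right hD _) _)
    · rw [show 4 * P ^ 2 * f.derivV u v
          = (2 * P * u + Q * v) * (f.b * (2 * P * u + Q * v) - 2 * f.b * Q * v + 4 * f.c * P * v)
            - 3 * f.b * f.disc * v ^ 2 by
        simp only [hP, hQ, BinaryCubic.derivV, BinaryCubic.disc_eq]; ring]
      exact dvd_sub (dvd_mul_of_dvd_left hL _)
        (dvd_mul_of_dvd_left (dvd_mul_of_dvd_right hD _) _)

/-! ## 3. Minimality of data at `p ≥ 5` -/

/-- **Index-form data of maximal rings are minimal Weierstrass pairs away from `6`** (registered sub-goal of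
stmt-ABC-1975, stub `stub_ringCensus`): for `F` maximal, `F(q) ≠ 0` and a content with `p² ∤ gcd q` at every prime
`p ≥ 5`, the pair `(c₄, c₆) = (16·H_F(q), −32·G_F(q))` has `¬ (p⁴ ∣ c₄ ∧ p⁶ ∣ c₆)` for every prime `p ≥ 5`
(the `p ≥ 5` clause of `TF`). -/
theorem data_tf_five : ∀ (F : BinaryCubic ℤ), RingOfForm.IsMaximal F → ∀ (q : ℤ × ℤ), F.eval q.1 q.2 ≠ 0 → (∀ p : ℕ, p.Prime → 5 ≤ p → ¬ p ^ 2 ∣ Int.gcd q.1 q.2) → ∀ (p : ℕ), p.Prime → 5 ≤ p → ¬ ((p : ℤ) ^ 4 ∣ 16 * hessAt F q.1 q.2 ∧ (p : ℤ) ^ 6 ∣ 32 * covAt F q.1 q.2) := by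
  intro F hF q hq htf p hp hp5 ⟨h4, h6⟩
  have hp' : Prime (p : ℤ) := Nat.prime_iff_prime_int.mp hp
  have hnd2 : ¬ (p : ℤ) ∣ 2 := fun h => by have := Int.le_of_dvd (by norm_num) h; omega
  have hnd3 : ¬ (p : ℤ) ∣ 3 := fun h => by have := Int.le_of_dvd (by norm_num) h; omega
  have hc2 : IsCoprime (p : ℤ) 2 := (Irreducible.coprime_iff_not_dvd hp'.irreducible).mpr hnd2
  have hc3 : IsCoprime (p : ℤ) 3 := (Irreducible.coprime_iff_not_dvd hp'.irreducible).mpr hnd3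
  have hU : F.MemU p := RingOfForm.memU_of_isMaximal hF hp.one_lt
  -- strip `16 = 2⁴` and `32 = 2⁵`
  have h4' : (p : ℤ) ^ 4 ∣ hessAt F q.1 q.2 := by
    rw [show (16 : ℤ) = 2 ^ 4 by norm_num] at h4
    exact (IsCoprime.pow hc2).dvd_of_dvd_mul_left h4
  have h6' : (p : ℤ) ^ 6 ∣ covAt F q.1 q.2 := by
    rw [show (32 : ℤ) = 2 ^ 5 by norm_num] at h6
    exact (IsCoprime.pow hc2).dvd_of_dvd_mul_left h6
  -- primitive decomposition and valuations at `q₀ = (u, v)`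
  obtain ⟨u, v, hcop, eH, eG, eF, hF0⟩ := exists_primitive F hq
  have hg : ¬ (p : ℤ) ^ (1 + 1) ∣ (Int.gcd q.1 q.2 : ℤ) := by exact_mod_cast htf p hp hp5
  have hH2 : (p : ℤ) ^ 2 ∣ hessAt F u v :=
    pow_dvd_of_pow_dvd_pow_mul hp hg (by rw [← eH]; exact h4') (by norm_num)
  have hG3 : (p : ℤ) ^ 3 ∣ covAt F u v :=
    pow_dvd_of_pow_dvd_pow_mul hp hg (by rw [← eG]; exact h6') (by norm_num)
  have h27 : (p : ℤ) ^ 6 ∣ 27 * F.disc * F.eval u v ^ 2 := pow_dvd_disc_mul_sq hH2 hG3 (by norm_num) (by norm_num)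
  have hDF : (p : ℤ) ^ 6 ∣ F.disc * F.eval u v ^ 2 := by
    rw [show (27 : ℤ) = 3 ^ 3 by norm_num, mul_assoc] at h27
    exact (IsCoprime.pow hc3).dvd_of_dvd_mul_left h27
  have hD3 : ¬ (p : ℤ) ^ (2 + 1) ∣ F.disc := BinaryCubic.not_cube_dvd_disc_of_memU hp hp5 hU
  have hF2 : (p : ℤ) ^ 2 ∣ F.eval u v := pow_dvd_of_pow_dvd_mul_sq hp hD3 hF0 hDF (by norm_num)
  have hH1 : (p : ℤ) ∣ hessAt F u v := (dvd_pow_self _ two_ne_zero).trans hH2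
  have hF1 : (p : ℤ) ∣ F.eval u v := (dvd_pow_self _ two_ne_zero).trans hF2
  -- `p ∣ D` (resultant step), so `q₀` is a singular zero with `p² ∣ F(q₀)`: contradiction with `F ∈ U_p`
  have hpD : (p : ℤ) ∣ F.disc := dvd_disc_of_dvd_eval_hessAt hcop hF1 hH1
  obtain ⟨hdu, hdv⟩ := dvd_deriv_of_dvd_disc hp hp5 hU.1 hpD hF1 hH1
  exact (BinaryCubic.memU_iff_forall_coprime.mp hU).2 u v hcop hF2 hdu hdv

/-! ## 4. Bounded non-minimality at `2` and `3` (descaling depth `T = 2`) -/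

/-- **Bounded non-minimality at `2`** (registered sub-goal of stmt-ABC-1975, stub `stub_ringCensus`; descaling depth
`T = 2`): for `F` maximal, `F(q) ≠ 0`, `2⁴ ∤ gcd q`, the pair `(c₄, c₆) = (16·H_F(q), −32·G_F(q))` does NOT have
`2^{8+4·2} ∣ c₄ ∧ 2^{11+6·2} ∣ c₆` (else `2⁴ ∣ F(q₀), H_F(q₀)` at the primitive `q₀`, so `2⁴ ∣ Disc F`, contradicting
`2⁴ ∤ Disc` of a maximal form). -/
theorem data_descale_two : ∀ (F : BinaryCubic ℤ), RingOfForm.IsMaximal F → ∀ (q : ℤ × ℤ), F.eval q.1 q.2 ≠ 0 → ¬ 2 ^ 4 ∣ Int.gcd q.1 q.2 → ¬ ((2 : ℤ) ^ (8 + 4 * 2) ∣ 16 * hessAt F q.1 q.2 ∧ (2 : ℤ) ^ (11 + 6 * 2) ∣ 32 * covAt F q.1 q.2) := by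
  intro F hF q hq htf ⟨h4, h6⟩
  have hU : F.MemU 2 := RingOfForm.memU_of_isMaximal hF (by norm_num)
  have h4' : (2 : ℤ) ^ 12 ∣ hessAt F q.1 q.2 := by
    rw [show (2 : ℤ) ^ (8 + 4 * 2) = 16 * 2 ^ 12 by norm_num] at h4
    exact (mul_dvd_mul_iff_left (by norm_num)).mp h4
  have h6' : (2 : ℤ) ^ 18 ∣ covAt F q.1 q.2 := by
    rw [show (2 : ℤ) ^ (11 + 6 * 2) = 32 * 2 ^ 18 by norm_num] at h6
    exact (mul_dvd_mul_iff_left (by norm_num)).mp h6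
  obtain ⟨u, v, hcop, eH, eG, eF, hF0⟩ := exists_primitive F hq
  have hg : ¬ ((2 : ℕ) : ℤ) ^ (3 + 1) ∣ (Int.gcd q.1 q.2 : ℤ) := by exact_mod_cast htf
  have hH : ((2 : ℕ) : ℤ) ^ 6 ∣ hessAt F u v :=
    pow_dvd_of_pow_dvd_pow_mul Nat.prime_two hg (by rw [← eH]; exact_mod_cast h4') (by norm_num)
  have hG : ((2 : ℕ) : ℤ) ^ 9 ∣ covAt F u v :=
    pow_dvd_of_pow_dvd_pow_mul Nat.prime_two hg (by rw [← eG]; exact_mod_cast h6') (by norm_num)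
  have h27 : ((2 : ℕ) : ℤ) ^ 18 ∣ 27 * F.disc * F.eval u v ^ 2 := pow_dvd_disc_mul_sq hH hG (by norm_num) (by norm_num)
  have hDF : ((2 : ℕ) : ℤ) ^ 18 ∣ F.disc * F.eval u v ^ 2 := by
    rw [mul_assoc] at h27
    exact (Int.isCoprime_iff_gcd_eq_one.mpr (by norm_num)).dvd_of_dvd_mul_left h27
  have hD4 : ¬ ((2 : ℕ) : ℤ) ^ (3 + 1) ∣ F.disc := by
    exact_mod_cast BinaryCubic.not_two_pow_four_dvd_disc_of_memU hU
  have hF4 : ((2 : ℕ) : ℤ) ^ 4 ∣ F.eval u v := pow_dvd_of_pow_dvd_mul_sq Nat.prime_two hD4 hF0 hDF (by norm_num)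
  have hH4 : ((2 : ℕ) : ℤ) ^ 4 ∣ hessAt F u v := (pow_dvd_pow _ (by norm_num)).trans hH
  exact hD4 (dvd_disc_of_dvd_eval_hessAt hcop hF4 hH4)

/-- **Bounded non-minimality at `3`** (registered sub-goal of stmt-ABC-1975, stub `stub_ringCensus`; descaling depth
`T = 2`): for `F` maximal, `F(q) ≠ 0`, `3⁴ ∤ gcd q`, the pair `(c₄, c₆) = (16·H_F(q), −32·G_F(q))` does NOT have
`3^{5+4·2} ∣ c₄ ∧ 3^{9+6·2} ∣ c₆` (else `3⁶ ∣ F(q₀), H_F(q₀)` at the primitive `q₀`, so `3⁶ ∣ Disc F`, contradicting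
`3⁶ ∤ Disc` of a maximal form). -/
theorem data_descale_three : ∀ (F : BinaryCubic ℤ), RingOfForm.IsMaximal F → ∀ (q : ℤ × ℤ), F.eval q.1 q.2 ≠ 0 → ¬ 3 ^ 4 ∣ Int.gcd q.1 q.2 → ¬ ((3 : ℤ) ^ (5 + 4 * 2) ∣ 16 * hessAt F q.1 q.2 ∧ (3 : ℤ) ^ (9 + 6 * 2) ∣ 32 * covAt F q.1 q.2) := by
  intro F hF q hq htf ⟨h4, h6⟩
  have hU : F.MemU 3 := RingOfForm.memU_of_isMaximal hF (by norm_num)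
  have h4' : (3 : ℤ) ^ 13 ∣ hessAt F q.1 q.2 := by
    have hc : IsCoprime ((3 : ℤ) ^ 13) 16 := Int.isCoprime_iff_gcd_eq_one.mpr (by norm_num)
    rw [show (3 : ℤ) ^ (5 + 4 * 2) = 3 ^ 13 by norm_num] at h4
    exact hc.dvd_of_dvd_mul_left h4
  have h6' : (3 : ℤ) ^ 21 ∣ covAt F q.1 q.2 := by
    have hc : IsCoprime ((3 : ℤ) ^ 21) 32 := Int.isCoprime_iff_gcd_eq_one.mpr (by norm_num)
    rw [show (3 : ℤ) ^ (9 + 6 * 2) = 3 ^ 21 by norm_num] at h6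
    exact hc.dvd_of_dvd_mul_left h6
  obtain ⟨u, v, hcop, eH, eG, eF, hF0⟩ := exists_primitive F hq
  have hg : ¬ ((3 : ℕ) : ℤ) ^ (3 + 1) ∣ (Int.gcd q.1 q.2 : ℤ) := by exact_mod_cast htf
  have hH : ((3 : ℕ) : ℤ) ^ 7 ∣ hessAt F u v :=
    pow_dvd_of_pow_dvd_pow_mul Nat.prime_three hg (by rw [← eH]; exact_mod_cast h4') (by norm_num)
  have hG : ((3 : ℕ) : ℤ) ^ 12 ∣ covAt F u v :=
    pow_dvd_of_pow_dvd_pow_mul Nat.prime_three hg (by rw [← eG]; exact_mod_cast h6') (by norm_num)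
  have h27 : ((3 : ℕ) : ℤ) ^ 21 ∣ 27 * F.disc * F.eval u v ^ 2 := pow_dvd_disc_mul_sq hH hG (by norm_num) (by norm_num)
  have hDF : ((3 : ℕ) : ℤ) ^ 18 ∣ F.disc * F.eval u v ^ 2 := by
    rw [mul_assoc, show ((3 : ℕ) : ℤ) ^ 21 = 27 * ((3 : ℕ) : ℤ) ^ 18 by norm_num] at h27
    exact (mul_dvd_mul_iff_left (by norm_num)).mp h27
  have hD6 : ¬ ((3 : ℕ) : ℤ) ^ (5 + 1) ∣ F.disc := by
    exact_mod_cast BinaryCubic.not_three_pow_six_dvd_disc_of_memU hU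
  have hF6 : ((3 : ℕ) : ℤ) ^ 6 ∣ F.eval u v := pow_dvd_of_pow_dvd_mul_sq Nat.prime_three hD6 hF0 hDF (by norm_num)
  have hH6 : ((3 : ℕ) : ℤ) ^ 6 ∣ hessAt F u v := (pow_dvd_pow _ (by norm_num)).trans hH
  exact hD6 (dvd_disc_of_dvd_eval_hessAt hcop hF6 hH6)

end Summit.ABC.ABC.Theorems.SharpModerateLaw
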